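import Literature.NumberTheory.Transcendental.ZeroEstNullstellensatz
import Literature.NumberTheory.Transcendental.ZeroEstHilbert
import Literature.NumberTheory.Transcendental.PhilipponZeroEstimatePrelim
import HarnessLib

/-!
# Zero estimates on commutative algebraic groups, XIV: translates, stabilisers and identity components

Topic `Literature/NumberTheory/Transcendental`. Fourteenth module of the discharge of
`Literature.NumberTheory.Transcendental.philippon1986_std` through D. Roy's exposition of
Philippon's zero estimate (Nesterenko–Philippon (eds.), LNM 1752, Ch. 11, proof of Thm. 4.1) for
an abstract analytic group model `M : AnalyticGroupModel V N`: the group-theoretic part of the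
descent, i.e. the tree's `PhilipponZeroEstimateP1nDescent.lean` (§ stabiliser) and
`GaGmSubgroups.lean` (§ closed subgroups) for the additive group `V` and the `Θ`-Zariski topology.

* **Translation invariance of the dimension** (`coneDim_vadd`): from the injection
  `ℂ[X]_{≤t}/𝔍(a + X) ↪ ∏_α ℂ[X]_{≤ct}/𝔍(X)`, `P ↦ (translForm α a P)_α`
  (`hilbC_vanishing_vadd_le`) and the sandwich of `ZeroEstHilbert.lean`
  (`exponent_le_of_choose_le`); this needs `c = lawDeg ≥ 1`.
* **Stabilisers** (`stab X`): for irreducible closed `X`, `a + X ⊆ X` forces `a + X = X`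
  (`vadd_eq_of_vadd_subset`), the stabiliser is a closed subgroup (`isClosedG_stab`).
* **Closed subgroups** `H`: translations by `H` permute the components (`vadd_comp_eq_comp`),
  the components are pairwise disjoint (`comps_disjoint`), the component `H₀ = idComp H` through
  `0` is a closed irreducible subgroup (`idComp`, `isIrred_idComp`) and `H` is a finite union of
  its cosets (`exists_finset_eq_biUnion_vadd_idComp`).

Everything is PROVED; no named facts.

## References

* Yu. V. Nesterenko, P. Philippon (eds.), *Introduction to Algebraic Independence Theory*,
  LNM 1752, Springer 2001, Ch. 11 (D. Roy), Thm. 4.1 (proof, pp. 219–220), Prop. 2.3. [NesterenkoPhilippon2001]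
* A. Borel, *Linear Algebraic Groups*, §1.2 (identity component). [folklore]
-/

noncomputable section

open MvPolynomial Set Module
open scoped Pointwise

namespace Literature.NumberTheory.Transcendental

namespace AnalyticGroupModel

variable {V : Type*} [NormedAddCommGroup V] [NormedSpace ℂ V] {N : ℕ} (M : AnalyticGroupModel V N)

attribute [local instance] MvPolynomial.gradedAlgebra

/-! ### Hilbert functions of translates -/

/-- `translForm` of a finite sum. [folklore] -/
theorem translForm_sum (α : Fin M.nLaw) (a : V) {ι : Type*} (s : Finset ι) (f : ι → MvPolynomial (Fin (N + 1)) ℂ) :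
    M.translForm α a (∑ i ∈ s, f i) = ∑ i ∈ s, M.translForm α a (f i) := by
  simp only [translForm, map_sum]

/-- `translForm` of `0`. [folklore] -/
@[simp] theorem translForm_zero (α : Fin M.nLaw) (a : V) : M.translForm α a 0 = 0 := by
  simp only [translForm, map_zero]

/-- `translForm α a` maps `ℂ[X]_{≤t}` into `ℂ[X]_{≤ct}`. [folklore] -/
theorem translForm_mem_Fil (α : Fin M.nLaw) (a : V) {P : MvPolynomial (Fin (N + 1)) ℂ} {t : ℕ}
    (hP : P ∈ ZeroEst.Fil (N := N) t) : M.translForm α a P ∈ ZeroEst.Fil (N := N) (M.lawDeg * t) := by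
  classical
  rw [ZeroEst.mem_Fil] at hP ⊢
  rw [← sum_homogeneousComponent P, translForm_sum]
  refine (totalDegree_finsetSum _ _).trans (Finset.sup_le fun e he => ?_)
  have het : e ≤ t := by rw [Finset.mem_range] at he; omega
  have hh := M.isHomogeneous_translForm α a (homogeneousComponent_isHomogeneous e P)
  by_cases h0 : M.translForm α a (homogeneousComponent e P) = 0
  · rw [h0, totalDegree_zero]; exact Nat.zero_le _
  · rw [hh.totalDegree h0]
    exact Nat.mul_le_mul_left _ het

/-- Membership of an arbitrary polynomial in `𝔍(a + X)`: all its translates lie in `𝔍(X)`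
(`c ≥ 1`). [folklore] -/
theorem mem_vanishing_vadd_iff' (hc : 1 ≤ M.lawDeg) {X : Set V} (a : V) {P : MvPolynomial (Fin (N + 1)) ℂ} :
    P ∈ M.vanishing (a +ᵥ X) ↔ ∀ α, M.translForm α a P ∈ M.vanishing X := by
  classical
  constructor
  · intro hP α
    rw [← sum_homogeneousComponent P, translForm_sum]
    refine Submodule.sum_mem _ fun e _ => ?_
    exact (M.mem_vanishing_vadd_iff (homogeneousComponent_isHomogeneous e P) a).mp
      (M.homogeneousComponent_mem_vanishing hP e) α
  · intro h
    -- each homogeneous component of `P` lies in `𝔍(a + X)`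
    rw [← sum_homogeneousComponent P]
    refine Submodule.sum_mem _ fun e _ => ?_
    rw [M.mem_vanishing_vadd_iff (homogeneousComponent_isHomogeneous e P) a]
    intro α
    -- `translForm α a (P_e)` is the component of degree `c e` of `translForm α a P`
    have hcomp : homogeneousComponent (M.lawDeg * e) (M.translForm α a P) = M.translForm α a (homogeneousComponent e P) := by
      conv_lhs => rw [← sum_homogeneousComponent P, translForm_sum, map_sum]
      rw [Finset.sum_eq_single e]
      · rw [homogeneousComponent_of_mem (M.isHomogeneous_translForm α a (homogeneousComponent_isHomogeneous e P)), if_pos rfl]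
      · intro b _ hb
        rw [homogeneousComponent_of_mem (M.isHomogeneous_translForm α a (homogeneousComponent_isHomogeneous b P)), if_neg]
        intro hbe
        exact hb (by have h' := Nat.eq_of_mul_eq_mul_left hc hbe; omega)
      · intro he
        rw [Finset.mem_range, not_lt] at he
        rw [homogeneousComponent_eq_zero e P (by omega), translForm_zero, map_zero]
    rw [← hcomp]
    exact M.homogeneousComponent_mem_vanishing (h α) _

/-- **The Hilbert function of a translate**: `H_{𝔍(a+X)}(t) ≤ (#laws) · H_{𝔍(X)}(c t)`, from the
injection `P ↦ (translForm α a P)_α`. [cite: NesterenkoPhilippon2001, Ch. 11 Prop. 2.3 (proof)] -/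
theorem hilbC_vanishing_vadd_le (hc : 1 ≤ M.lawDeg) (X : Set V) (a : V) (t : ℕ) :
    ZeroEst.hilbC ((M.vanishing (a +ᵥ X)).restrictScalars ℂ) t ≤
      M.nLaw * ZeroEst.hilbC (N := N) ((M.vanishing X).restrictScalars ℂ) (M.lawDeg * t) := by
  classical
  set A := ZeroEst.Fil (N := N) t with hA
  set W : Submodule ℂ (MvPolynomial (Fin (N + 1)) ℂ ⧸ M.vanishing X) :=
    (ZeroEst.Fil (N := N) (M.lawDeg * t)).map (Ideal.Quotient.mkₐ ℂ (M.vanishing X)).toLinearMap with hW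
  -- the comparison map `A → (Fin nLaw → W)`
  have hmemW : ∀ (α : Fin M.nLaw) (P : ↥A), Ideal.Quotient.mkₐ ℂ (M.vanishing X) (M.translForm α a P) ∈ W :=
    fun α P => ⟨M.translForm α a P, M.translForm_mem_Fil α a P.2, rfl⟩
  set T : ↥A →ₗ[ℂ] (Fin M.nLaw → ↥W) :=
    LinearMap.pi fun α => LinearMap.codRestrict W
      ((Ideal.Quotient.mkₐ ℂ (M.vanishing X)).toLinearMap ∘ₗ
        (bind₁ fun I => M.lawAt α I a : MvPolynomial (Fin (N + 1)) ℂ →ₐ[ℂ] MvPolynomial (Fin (N + 1)) ℂ).toLinearMap ∘ₗ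
          A.subtype)
      (fun P => hmemW α P) with hT
  have hker : LinearMap.ker T = ((M.vanishing (a +ᵥ X)).restrictScalars ℂ).comap A.subtype := by
    ext P
    simp only [LinearMap.mem_ker, Submodule.mem_comap, Submodule.coe_subtype, Submodule.restrictScalars_mem, hT,
      _root_.funext_iff, LinearMap.pi_apply, Pi.zero_apply]
    rw [M.mem_vanishing_vadd_iff' hc a]
    refine forall_congr' fun α => ?_
    rw [Subtype.ext_iff, LinearMap.codRestrict_apply]
    simp [Ideal.Quotient.eq_zero_iff_mem]
    rfl
  have hrank := LinearMap.finrank_range_add_finrank_ker T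
  have hkerdim : finrank ℂ (LinearMap.ker T) = finrank ℂ ↥(A ⊓ (M.vanishing (a +ᵥ X)).restrictScalars ℂ) := by
    rw [hker]
    have e : Submodule.comap A.subtype ((M.vanishing (a +ᵥ X)).restrictScalars ℂ) =
        Submodule.comap A.subtype (A ⊓ (M.vanishing (a +ᵥ X)).restrictScalars ℂ) := by
      rw [Submodule.comap_inf, Submodule.comap_subtype_self, top_inf_eq]
    rw [e]
    exact (Submodule.comapSubtypeEquivOfLe inf_le_left).finrank_eq
  have hrange : finrank ℂ (LinearMap.range T) ≤ M.nLaw * finrank ℂ ↥W := by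
    calc finrank ℂ (LinearMap.range T) ≤ finrank ℂ (Fin M.nLaw → ↥W) := Submodule.finrank_le _
      _ = M.nLaw * finrank ℂ ↥W := by rw [Module.finrank_pi_fintype, Finset.sum_const, Finset.card_univ,
          Fintype.card_fin, smul_eq_mul]
  have h1 := ZeroEst.hilbC_add_finrank_inf (N := N) ((M.vanishing (a +ᵥ X)).restrictScalars ℂ) t
  rw [← hA] at h1
  have hfin : finrank ℂ (LinearMap.range T) = ZeroEst.hilbC ((M.vanishing (a +ᵥ X)).restrictScalars ℂ) t := by
    have h2 : finrank ℂ (LinearMap.range T) + finrank ℂ ↥(A ⊓ (M.vanishing (a +ᵥ X)).restrictScalars ℂ) =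
        finrank ℂ ↥A := by rw [← hkerdim]; exact hrank
    omega
  rw [ZeroEst.hilbC_eq_finrank_map (M.vanishing X) (M.lawDeg * t), ← hW, ← hfin]
  exact hrange

/-! ### Growth exponents -/

omit M in
/-- **Comparison of growth exponents**: if `ρ₁ binom(t - a₁ + d₁, d₁) ≤ K ρ₂ binom(c t + γ₂ + d₂, d₂)`
for all large `t`, with `ρ₁ ≥ 1`, then `d₁ ≤ d₂`. [folklore] -/
theorem exponent_le_of_choose_le {d₁ d₂ ρ₁ ρ₂ a₁ γ₂ K c t₀ : ℕ} (hρ₁ : 1 ≤ ρ₁)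
    (h : ∀ t, t₀ ≤ t → ρ₁ * (t - a₁ + d₁).choose d₁ ≤ K * (ρ₂ * (c * t + γ₂ + d₂).choose d₂)) : d₁ ≤ d₂ := by
  by_contra hlt
  push Not at hlt
  set L := c + c * a₁ + γ₂ + d₂ + 1 with hL
  set B := d₁.factorial * K * ρ₂ * L ^ d₂ with hB
  set t := B + a₁ + t₀ with ht
  set n := t - a₁ with hn
  have hn' : n = B + t₀ := by omega
  have h1 := h t (by omega)
  -- lower bound `(n+1)^{d₁} ≤ d₁! ρ₁ binom(n + d₁, d₁)`
  have h2 : (n + 1) ^ d₁ ≤ d₁.factorial * (ρ₁ * (n + d₁).choose d₁) := by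
    calc (n + 1) ^ d₁ ≤ d₁.factorial * (n + d₁).choose d₁ := GaGm.pow_succ_le_factorial_mul_choose n d₁
      _ ≤ d₁.factorial * (ρ₁ * (n + d₁).choose d₁) := Nat.mul_le_mul_left _ (Nat.le_mul_of_pos_left _ hρ₁)
  -- upper bound `binom(ct + γ₂ + d₂, d₂) ≤ (L (n+1))^{d₂}`
  have htn : t = n + a₁ := by omega
  have hlin : c * t + γ₂ + d₂ ≤ L * (n + 1) := by
    have hX : c ≤ L := by rw [hL]; omega
    calc c * t + γ₂ + d₂ = c * n + (c * a₁ + γ₂ + d₂) := by rw [htn]; ring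
      _ ≤ L * n + L := add_le_add (Nat.mul_le_mul_right _ hX) (by rw [hL]; omega)
      _ = L * (n + 1) := by ring
  have h3 : (c * t + γ₂ + d₂).choose d₂ ≤ (L * (n + 1)) ^ d₂ := by
    calc (c * t + γ₂ + d₂).choose d₂ ≤ (c * t + γ₂ + d₂) ^ d₂ := Nat.choose_le_pow _ _
      _ ≤ (L * (n + 1)) ^ d₂ := Nat.pow_le_pow_left hlin _
  have h4 : (n + 1) ^ d₁ ≤ B * (n + 1) ^ d₂ := by
    calc (n + 1) ^ d₁ ≤ d₁.factorial * (ρ₁ * (n + d₁).choose d₁) := h2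
      _ ≤ d₁.factorial * (K * (ρ₂ * (c * t + γ₂ + d₂).choose d₂)) := Nat.mul_le_mul_left _ h1
      _ ≤ d₁.factorial * (K * (ρ₂ * (L * (n + 1)) ^ d₂)) :=
          Nat.mul_le_mul_left _ (Nat.mul_le_mul_left _ (Nat.mul_le_mul_left _ h3))
      _ = B * (n + 1) ^ d₂ := by rw [hB, mul_pow]; ring
  -- `(n+1)^{d₂} (n+1) ≤ (n+1)^{d₁}` so `n + 1 ≤ B`
  have h5 : (n + 1) ^ d₂ * (n + 1) ≤ (n + 1) ^ d₁ := by
    rw [← pow_succ]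
    exact Nat.pow_le_pow_right (Nat.succ_pos n) hlt
  have h6 : (n + 1) ^ d₂ * (n + 1) ≤ (n + 1) ^ d₂ * B := by
    calc (n + 1) ^ d₂ * (n + 1) ≤ (n + 1) ^ d₁ := h5
      _ ≤ B * (n + 1) ^ d₂ := h4
      _ = (n + 1) ^ d₂ * B := mul_comm _ _
  have h7 : n + 1 ≤ B := Nat.le_of_mul_le_mul_left h6 (pow_pos (Nat.succ_pos n) _)
  omega

/-! ### Translation invariance of the dimension -/

/-- `coneDim (a + X) ≤ coneDim X` for irreducible closed `X` (`c ≥ 1`). [cite: NesterenkoPhilippon2001, Ch. 11 Prop. 2.3] -/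
theorem coneDim_vadd_le_of_isIrred (hc : 1 ≤ M.lawDeg) {X : Set V} (hX : M.IsIrred X) (a : V) :
    M.coneDim (a +ᵥ X) ≤ M.coneDim X := by
  have hXa : M.IsIrred (a +ᵥ X) := hX.vadd M a
  haveI h1 := hXa.isPrime
  haveI h2 := hX.isPrime
  have hd₁ := (M.coneDim_eq hXa.nonempty).symm
  have hd₂ := (M.coneDim_eq hX.nonempty).symm
  obtain ⟨ρ₁, a₁, γ₁, hρ₁, hs₁⟩ := ZeroEst.exists_sandwich_of_isPrime (𝔭 := M.vanishing (a +ᵥ X)) hd₁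
  obtain ⟨ρ₂, a₂, γ₂, -, hs₂⟩ := ZeroEst.exists_sandwich_of_isPrime (𝔭 := M.vanishing X) hd₂
  have hnLaw : 1 ≤ M.nLaw := by
    obtain ⟨α, -⟩ := M.exists_lam_ne_zero 0 0
    exact Nat.one_le_iff_ne_zero.mpr fun h => (h ▸ α).elim0
  refine exponent_le_of_choose_le (K := M.nLaw) (c := M.lawDeg) (a₁ := a₁) (ρ₂ := ρ₂) (γ₂ := γ₂ + M.lawDeg * a₂) (t₀ := a₁ + a₂) hρ₁ fun t ht => ?_
  have e1 := (hs₁ t (by omega)).1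
  have e2 := M.hilbC_vanishing_vadd_le hc X a t
  have e3 := (hs₂ (M.lawDeg * t) (by nlinarith)).2
  calc ρ₁ * (t - a₁ + M.coneDim (a +ᵥ X)).choose (M.coneDim (a +ᵥ X))
      ≤ ZeroEst.hilbC ((M.vanishing (a +ᵥ X)).restrictScalars ℂ) t := e1
    _ ≤ M.nLaw * ZeroEst.hilbC (N := N) ((M.vanishing X).restrictScalars ℂ) (M.lawDeg * t) := e2
    _ ≤ M.nLaw * (ρ₂ * (M.lawDeg * t + γ₂ + M.coneDim X).choose (M.coneDim X)) := Nat.mul_le_mul_left _ e3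
    _ ≤ M.nLaw * (ρ₂ * (M.lawDeg * t + (γ₂ + M.lawDeg * a₂) + M.coneDim X).choose (M.coneDim X)) :=
        Nat.mul_le_mul_left _ (Nat.mul_le_mul_left _ (Nat.choose_le_choose _ (by omega)))

/-- **Translation invariance of the dimension** (`c ≥ 1`). [cite: NesterenkoPhilippon2001, Ch. 11 Prop. 2.3] -/
theorem coneDim_vadd (hc : 1 ≤ M.lawDeg) {X : Set V} (hX : M.IsClosedG X) (a : V) :
    M.coneDim (a +ᵥ X) = M.coneDim X := by
  -- `≤` for closed sets through a top component, then symmetry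
  have key : ∀ (Y : Set V), M.IsClosedG Y → ∀ b : V, M.coneDim (b +ᵥ Y) ≤ M.coneDim Y := by
    intro Y hY b
    by_cases hYne : (b +ᵥ Y).Nonempty
    · obtain ⟨𝔮, h𝔮, hdim⟩ := M.exists_minimalPrimes_coneDim_eq hYne
      obtain ⟨hirr, -, hsub⟩ := M.isIrred_zeroSet_of_mem_minimalPrimes h𝔮
      rw [(hY.vadd M b).eq] at hsub
      -- `-b + C ⊆ Y`
      have hsub' : (-b) +ᵥ M.zeroSet ((𝔮 : Ideal _) : Set (MvPolynomial (Fin (N + 1)) ℂ)) ⊆ Y := by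
        rintro _ ⟨c, hc', rfl⟩
        obtain ⟨y, hy, hyc⟩ := hsub hc'
        have : -b +ᵥ c = y := by rw [← hyc]; simp
        change -b +ᵥ c ∈ Y
        rw [this]; exact hy
      rw [← hdim]
      calc M.coneDim (M.zeroSet ((𝔮 : Ideal _) : Set (MvPolynomial (Fin (N + 1)) ℂ)))
          = M.coneDim (b +ᵥ ((-b) +ᵥ M.zeroSet ((𝔮 : Ideal _) : Set (MvPolynomial (Fin (N + 1)) ℂ)))) := by
            rw [vadd_vadd, add_neg_cancel, zero_vadd]
        _ ≤ M.coneDim ((-b) +ᵥ M.zeroSet ((𝔮 : Ideal _) : Set (MvPolynomial (Fin (N + 1)) ℂ))) :=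
            M.coneDim_vadd_le_of_isIrred hc (hirr.vadd M (-b)) b
        _ ≤ M.coneDim Y := M.coneDim_mono hsub'
    · rw [Set.not_nonempty_iff_eq_empty] at hYne
      rw [hYne, coneDim_empty]
      exact Nat.zero_le _
  refine le_antisymm (key X hX a) ?_
  have := key (a +ᵥ X) (hX.vadd M a) (-a)
  rwa [vadd_vadd, neg_add_cancel, zero_vadd] at this

/-! ### The stabiliser of an irreducible closed set -/

section Stab

variable (hc : 1 ≤ M.lawDeg)
include hc

/-- `a + X ⊆ X` forces `a + X = X` for irreducible closed `X`. [folklore] -/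
theorem vadd_eq_of_vadd_subset {X : Set V} (hX : M.IsIrred X) {a : V} (h : a +ᵥ X ⊆ X) : a +ᵥ X = X :=
  hX.eq_of_subset_of_coneDim_eq M ((hX.vadd M a).isClosedG) (hX.nonempty.image _) h (M.coneDim_vadd hc hX.isClosedG a).symm.le

omit [NormedSpace ℂ V] M hc in
/-- **The stabiliser** of a set under translation. [folklore] -/
def stab (X : Set V) : AddSubgroup V where
  carrier := {a | a +ᵥ X = X}
  zero_mem' := zero_vadd V X
  add_mem' := by
    intro a b ha hb
    change (a + b) +ᵥ X = X
    rw [← vadd_vadd, hb, ha]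
  neg_mem' := by
    intro a ha
    change (-a) +ᵥ X = X
    conv_lhs => rw [← ha]
    rw [vadd_vadd, neg_add_cancel, zero_vadd]

omit [NormedSpace ℂ V] M hc in
/-- Membership in the stabiliser. [folklore] -/
theorem mem_stab_iff {X : Set V} {a : V} : a ∈ stab X ↔ a +ᵥ X = X := Iff.rfl

/-- For irreducible closed `X`, the stabiliser is `{a ; a + X ⊆ X} = ⋂_{x ∈ X} (-x + X)`. [folklore] -/
theorem coe_stab_eq {X : Set V} (hX : M.IsIrred X) : ((stab X : AddSubgroup V) : Set V) = ⋂ x ∈ X, ((-x) +ᵥ X) := by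
  ext a
  simp only [SetLike.mem_coe, mem_stab_iff, Set.mem_iInter]
  constructor
  · intro h x hx
    refine ⟨a + x, h.le ⟨x, hx, rfl⟩, ?_⟩
    show -x + (a + x) = a; abel
  · intro h
    refine M.vadd_eq_of_vadd_subset hc hX ?_
    rintro _ ⟨x, hx, rfl⟩
    obtain ⟨y, hy, hya⟩ := h x hx
    have : a +ᵥ x = y := by
      rw [vadd_eq_add, ← hya]; show (-x + y) + x = y; abel
    change a +ᵥ x ∈ X
    rw [this]; exact hy

/-- **The stabiliser of an irreducible closed set is a closed subgroup.** [folklore] -/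
theorem isClosedG_stab {X : Set V} (hX : M.IsIrred X) : M.IsClosedG ((stab X : AddSubgroup V) : Set V) := by
  rw [M.coe_stab_eq hc hX]
  haveI : Nonempty X := hX.nonempty.to_subtype
  have : (⋂ x ∈ X, ((-x) +ᵥ X)) = ⋂ x : X, ((-(x : V)) +ᵥ X) := by
    ext a; simp [Set.mem_iInter]
  rw [this]
  exact IsClosedG.iInter M fun x => hX.isClosedG.vadd M (-(x : V))

end Stab

/-! ### Closed subgroups: components are the cosets of the identity component -/

/-- The components of a closed set: the zero sets of the minimal primes of its ideal. [folklore] -/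
def comps (X : Set V) : Finset (Ideal (MvPolynomial (Fin (N + 1)) ℂ)) :=
  (Ideal.finite_minimalPrimes_of_isNoetherianRing _ (M.vanishing X)).toFinset

/-- Membership in `comps`. [folklore] -/
theorem mem_comps {X : Set V} {𝔮 : Ideal (MvPolynomial (Fin (N + 1)) ℂ)} :
    𝔮 ∈ M.comps X ↔ 𝔮 ∈ (M.vanishing X).minimalPrimes := by
  rw [comps, Set.Finite.mem_toFinset]

section ClosedSubgroup

variable (H : AddSubgroup V) (hH : M.IsClosedG (H : Set V))
include hH

/-- Translations by elements of a closed subgroup permute its components. [folklore] -/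
theorem vadd_comp_eq_comp {𝔮 : Ideal (MvPolynomial (Fin (N + 1)) ℂ)} (h𝔮 : 𝔮 ∈ M.comps (H : Set V))
    {h : V} (hh : h ∈ H) :
    ∃ 𝔮' ∈ M.comps (H : Set V), h +ᵥ M.zeroSet ((𝔮 : Ideal _) : Set (MvPolynomial (Fin (N + 1)) ℂ)) =
      M.zeroSet ((𝔮' : Ideal _) : Set (MvPolynomial (Fin (N + 1)) ℂ)) := by
  rw [mem_comps] at h𝔮
  obtain ⟨hirr, -, hsub⟩ := M.isIrred_zeroSet_of_mem_minimalPrimes h𝔮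
  rw [hH.eq] at hsub
  have hsubH : h +ᵥ M.zeroSet ((𝔮 : Ideal _) : Set (MvPolynomial (Fin (N + 1)) ℂ)) ⊆ (H : Set V) := by
    rintro _ ⟨c, hc', rfl⟩
    exact H.add_mem hh (hsub hc')
  obtain ⟨𝔮', h𝔮', hle⟩ := (hirr.vadd M h).exists_minimalPrimes_subset M hsubH
  refine ⟨𝔮', (M.mem_comps).mpr h𝔮', Set.Subset.antisymm hle ?_⟩
  obtain ⟨hirr', -, hsub'⟩ := M.isIrred_zeroSet_of_mem_minimalPrimes h𝔮'
  rw [hH.eq] at hsub'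
  have hsubH' : (-h) +ᵥ M.zeroSet ((𝔮' : Ideal _) : Set (MvPolynomial (Fin (N + 1)) ℂ)) ⊆ (H : Set V) := by
    rintro _ ⟨c, hc', rfl⟩
    exact H.add_mem (H.neg_mem hh) (hsub' hc')
  obtain ⟨𝔮'', h𝔮'', hle'⟩ := (hirr'.vadd M (-h)).exists_minimalPrimes_subset M hsubH'
  have hC : M.zeroSet ((𝔮 : Ideal _) : Set (MvPolynomial (Fin (N + 1)) ℂ)) ⊆ M.zeroSet 𝔮'' := by
    refine le_trans ?_ hle'
    intro c hc'
    exact Set.mem_neg_vadd_set_iff.mpr (hle (Set.vadd_mem_vadd_set hc'))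
  have heq := M.eq_of_zeroSet_subset_of_mem_minimalPrimes h𝔮 h𝔮'' hC
  subst heq
  intro c hc'
  have : (-h) +ᵥ c ∈ M.zeroSet ((𝔮 : Ideal _) : Set (MvPolynomial (Fin (N + 1)) ℂ)) := hle' (Set.vadd_mem_vadd_set hc')
  have e : c = h +ᵥ ((-h) +ᵥ c) := by rw [vadd_vadd, add_neg_cancel, zero_vadd]
  rw [e]
  exact Set.vadd_mem_vadd_set this

/-- The components of a closed subgroup are pairwise disjoint. [folklore] -/
theorem comps_disjoint {𝔮₁ 𝔮₂ : Ideal (MvPolynomial (Fin (N + 1)) ℂ)} (h𝔮₁ : 𝔮₁ ∈ M.comps (H : Set V))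
    (h𝔮₂ : 𝔮₂ ∈ M.comps (H : Set V)) (hne : 𝔮₁ ≠ 𝔮₂) :
    Disjoint (M.zeroSet ((𝔮₁ : Ideal _) : Set (MvPolynomial (Fin (N + 1)) ℂ))) (M.zeroSet 𝔮₂) := by
  classical
  rw [Set.disjoint_iff]
  rintro x ⟨hx₁, hx₂⟩
  exfalso
  set Pairs := ((M.comps (H : Set V)) ×ˢ (M.comps (H : Set V))).filter (fun pq => pq.1 ≠ pq.2) with hPairs
  have hxH : x ∈ (H : Set V) := by
    have := (M.isIrred_zeroSet_of_mem_minimalPrimes ((M.mem_comps).mp h𝔮₁)).2.2 hx₁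
    rwa [hH.eq] at this
  have hcover : (H : Set V) ⊆ ⋃ pq ∈ Pairs, (M.zeroSet ((pq.1 : Ideal _) : Set (MvPolynomial (Fin (N + 1)) ℂ)) ∩
      M.zeroSet ((pq.2 : Ideal _) : Set (MvPolynomial (Fin (N + 1)) ℂ))) := by
    intro h hh
    have hk : h + -x ∈ H := H.add_mem hh (H.neg_mem hxH)
    obtain ⟨𝔮₁', h𝔮₁', he₁⟩ := M.vadd_comp_eq_comp H hH h𝔮₁ hk
    obtain ⟨𝔮₂', h𝔮₂', he₂⟩ := M.vadd_comp_eq_comp H hH h𝔮₂ hk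
    have hne' : 𝔮₁' ≠ 𝔮₂' := by
      intro heq
      apply hne
      have hZ : M.zeroSet ((𝔮₁ : Ideal _) : Set (MvPolynomial (Fin (N + 1)) ℂ)) = M.zeroSet 𝔮₂ := by
        have h1 : (h + -x) +ᵥ M.zeroSet ((𝔮₁ : Ideal _) : Set (MvPolynomial (Fin (N + 1)) ℂ)) =
            (h + -x) +ᵥ M.zeroSet ((𝔮₂ : Ideal _) : Set (MvPolynomial (Fin (N + 1)) ℂ)) := by rw [he₁, he₂, heq]
        have h2 := congrArg (fun S : Set V => (-(h + -x)) +ᵥ S) h1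
        simpa only [neg_vadd_vadd] using h2
      exact M.eq_of_zeroSet_subset_of_mem_minimalPrimes ((M.mem_comps).mp h𝔮₁) ((M.mem_comps).mp h𝔮₂) hZ.le
    have hmem : ∀ 𝔮 : Ideal (MvPolynomial (Fin (N + 1)) ℂ), x ∈ M.zeroSet ((𝔮 : Ideal _) : Set (MvPolynomial (Fin (N + 1)) ℂ)) →
        h ∈ (h + -x) +ᵥ M.zeroSet ((𝔮 : Ideal _) : Set (MvPolynomial (Fin (N + 1)) ℂ)) := fun 𝔮 hx =>
      ⟨x, hx, by show h + -x + x = h; abel⟩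
    rw [Set.mem_iUnion₂]
    refine ⟨(𝔮₁', 𝔮₂'), ?_, ?_⟩
    · rw [hPairs, Finset.mem_filter, Finset.mem_product]; exact ⟨⟨h𝔮₁', h𝔮₂'⟩, hne'⟩
    · exact ⟨he₁ ▸ hmem 𝔮₁ hx₁, he₂ ▸ hmem 𝔮₂ hx₂⟩
  obtain ⟨hirr, -, hsub⟩ := M.isIrred_zeroSet_of_mem_minimalPrimes ((M.mem_comps).mp h𝔮₁)
  rw [hH.eq] at hsub
  obtain ⟨pq, hpq, hle⟩ := hirr.exists_subset_of_subset_biUnion M Pairs _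
    (fun pq hpq => by
      rw [hPairs, Finset.mem_filter, Finset.mem_product] at hpq
      exact (M.isIrred_zeroSet_of_mem_minimalPrimes ((M.mem_comps).mp hpq.1.1)).1.isClosedG.inter M
        (M.isIrred_zeroSet_of_mem_minimalPrimes ((M.mem_comps).mp hpq.1.2)).1.isClosedG)
    (hsub.trans hcover)
  rw [hPairs, Finset.mem_filter, Finset.mem_product] at hpq
  have e1 := M.eq_of_zeroSet_subset_of_mem_minimalPrimes ((M.mem_comps).mp h𝔮₁) ((M.mem_comps).mp hpq.1.1)
    (hle.trans Set.inter_subset_left)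
  have e2 := M.eq_of_zeroSet_subset_of_mem_minimalPrimes ((M.mem_comps).mp h𝔮₁) ((M.mem_comps).mp hpq.1.2)
    (hle.trans Set.inter_subset_right)
  exact hpq.2 (e1.symm.trans e2)

/-- A component of a closed subgroup contains `0`. [folklore] -/
theorem exists_comps_zero_mem : ∃ 𝔮 ∈ M.comps (H : Set V), (0 : V) ∈ M.zeroSet ((𝔮 : Ideal _) : Set (MvPolynomial (Fin (N + 1)) ℂ)) := by
  have h1 : (0 : V) ∈ (H : Set V) := H.zero_mem
  conv at h1 => rw [hH.eq_biUnion_minimalPrimes]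
  simp only [Set.mem_iUnion] at h1
  obtain ⟨𝔮, h𝔮, h1⟩ := h1
  exact ⟨𝔮, h𝔮, h1⟩

/-- The identity component, as a set: the component through `0`. [folklore] -/
def idCompSet : Set V :=
  M.zeroSet (((Classical.choose (M.exists_comps_zero_mem H hH)) : Ideal _) : Set (MvPolynomial (Fin (N + 1)) ℂ))

/-- The defining property of `idCompSet`. [folklore] -/
theorem idCompSet_spec : Classical.choose (M.exists_comps_zero_mem H hH) ∈ M.comps (H : Set V) ∧
    (0 : V) ∈ M.idCompSet H hH :=
  Classical.choose_spec (M.exists_comps_zero_mem H hH)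

/-- The identity component is irreducible closed. [folklore] -/
theorem isIrred_idCompSet : M.IsIrred (M.idCompSet H hH) :=
  (M.isIrred_zeroSet_of_mem_minimalPrimes ((M.mem_comps).mp (M.idCompSet_spec H hH).1)).1

/-- The identity component lies in `H`. [folklore] -/
theorem idCompSet_subset : M.idCompSet H hH ⊆ (H : Set V) := by
  have := (M.isIrred_zeroSet_of_mem_minimalPrimes ((M.mem_comps).mp (M.idCompSet_spec H hH).1)).2.2
  rwa [hH.eq] at this

/-- A component of `H` meeting `h + H₀` is `h + H₀`. [folklore] -/
theorem vadd_idCompSet_eq {h : V} (hh : h ∈ H) {𝔮 : Ideal (MvPolynomial (Fin (N + 1)) ℂ)}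
    (h𝔮 : 𝔮 ∈ M.comps (H : Set V))
    (hmeet : ((h +ᵥ M.idCompSet H hH) ∩ M.zeroSet ((𝔮 : Ideal _) : Set (MvPolynomial (Fin (N + 1)) ℂ))).Nonempty) :
    h +ᵥ M.idCompSet H hH = M.zeroSet ((𝔮 : Ideal _) : Set (MvPolynomial (Fin (N + 1)) ℂ)) := by
  obtain ⟨𝔮', h𝔮', he⟩ := M.vadd_comp_eq_comp H hH (M.idCompSet_spec H hH).1 hh
  change h +ᵥ M.idCompSet H hH = M.zeroSet ((𝔮' : Ideal _) : Set (MvPolynomial (Fin (N + 1)) ℂ)) at he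
  rw [he] at hmeet ⊢
  by_contra hne
  have hne' : 𝔮' ≠ 𝔮 := fun heq => hne (heq ▸ rfl)
  exact Set.not_nonempty_iff_eq_empty.mpr (Set.disjoint_iff_inter_eq_empty.mp (M.comps_disjoint H hH h𝔮' h𝔮 hne')) hmeet

/-- `c + H₀ = H₀` for `c ∈ H₀`. [folklore] -/
theorem vadd_idCompSet_self {c : V} (hc' : c ∈ M.idCompSet H hH) : c +ᵥ M.idCompSet H hH = M.idCompSet H hH :=
  M.vadd_idCompSet_eq H hH (M.idCompSet_subset H hH hc') (M.idCompSet_spec H hH).1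
    ⟨c, ⟨0, (M.idCompSet_spec H hH).2, by simp⟩, hc'⟩

/-- **The identity component `H₀` of a closed subgroup `H`.** [folklore] -/
def idComp : AddSubgroup V where
  carrier := M.idCompSet H hH
  zero_mem' := (M.idCompSet_spec H hH).2
  add_mem' := fun {a b} ha hb => by
    have h := M.vadd_idCompSet_self H hH ha
    rw [← h]
    exact Set.vadd_mem_vadd_set hb
  neg_mem' := fun {a} ha => by
    have h : (-a) +ᵥ M.idCompSet H hH = M.idCompSet H hH :=
      M.vadd_idCompSet_eq H hH (H.neg_mem (M.idCompSet_subset H hH ha)) (M.idCompSet_spec H hH).1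
        ⟨0, ⟨a, ha, by simp⟩, (M.idCompSet_spec H hH).2⟩
    have : (-a) +ᵥ (0 : V) ∈ (-a) +ᵥ M.idCompSet H hH := Set.vadd_mem_vadd_set (M.idCompSet_spec H hH).2
    rw [h, vadd_eq_add, add_zero] at this
    exact this

/-- The carrier of `idComp`. [folklore] -/
theorem coe_idComp : ((M.idComp H hH : AddSubgroup V) : Set V) = M.idCompSet H hH := rfl

/-- `H₀ ≤ H`. [folklore] -/
theorem idComp_le : M.idComp H hH ≤ H := fun _ hx => M.idCompSet_subset H hH hx

/-- `H₀` is irreducible closed. [folklore] -/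
theorem isIrred_idComp : M.IsIrred ((M.idComp H hH : AddSubgroup V) : Set V) := M.isIrred_idCompSet H hH

/-- **Finite index**: a closed subgroup is a finite union of cosets of its identity component.
[folklore] -/
theorem exists_finset_eq_biUnion_vadd_idComp :
    ∃ F : Finset V, (↑F : Set V) ⊆ H ∧
      (H : Set V) = ⋃ h ∈ F, h +ᵥ ((M.idComp H hH : AddSubgroup V) : Set V) := by
  classical
  have hpt : ∀ 𝔮 ∈ M.comps (H : Set V), ∃ h : V, h ∈ M.zeroSet ((𝔮 : Ideal _) : Set (MvPolynomial (Fin (N + 1)) ℂ)) :=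
    fun 𝔮 h𝔮 => (M.isIrred_zeroSet_of_mem_minimalPrimes ((M.mem_comps).mp h𝔮)).1.nonempty
  choose! pt hpt using hpt
  refine ⟨(M.comps (H : Set V)).image pt, ?_, ?_⟩
  · intro h hh
    rw [Finset.coe_image] at hh
    obtain ⟨𝔮, h𝔮, rfl⟩ := hh
    have := (M.isIrred_zeroSet_of_mem_minimalPrimes ((M.mem_comps).mp h𝔮)).2.2 (hpt 𝔮 h𝔮)
    rwa [hH.eq] at this
  · have hcomp : ∀ 𝔮 ∈ M.comps (H : Set V),
        pt 𝔮 +ᵥ ((M.idComp H hH : AddSubgroup V) : Set V) = M.zeroSet ((𝔮 : Ideal _) : Set (MvPolynomial (Fin (N + 1)) ℂ)) := by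
      intro 𝔮 h𝔮
      have hptH : pt 𝔮 ∈ H := by
        have := (M.isIrred_zeroSet_of_mem_minimalPrimes ((M.mem_comps).mp h𝔮)).2.2 (hpt 𝔮 h𝔮)
        rwa [hH.eq] at this
      exact M.vadd_idCompSet_eq H hH hptH h𝔮 ⟨pt 𝔮, ⟨0, (M.idCompSet_spec H hH).2, by simp⟩, hpt 𝔮 h𝔮⟩
    conv_lhs => rw [hH.eq_biUnion_minimalPrimes]
    ext g
    simp only [Set.mem_iUnion, Finset.mem_image, exists_prop]
    constructor
    · rintro ⟨𝔮, h𝔮, hg⟩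
      refine ⟨pt 𝔮, ⟨𝔮, (M.mem_comps).mpr (by simpa using h𝔮), rfl⟩, ?_⟩
      rw [hcomp 𝔮 ((M.mem_comps).mpr (by simpa using h𝔮))]; exact hg
    · rintro ⟨_, ⟨𝔮, h𝔮, rfl⟩, hg⟩
      refine ⟨𝔮, by simpa using (M.mem_comps).mp h𝔮, ?_⟩
      rw [hcomp 𝔮 h𝔮] at hg; exact hg

end ClosedSubgroup

end AnalyticGroupModel

end Literature.NumberTheory.Transcendental
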